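import Literature.Computability.Complexity.HamMatrixCircuits
import Literature.Computability.Complexity.SymmetricDnf
import HarnessLib

/-!
# Graph properties: matrix-input circuits versus the string language, for ANY property of coded graphs

`HamMatrixCircuits.lean` proves, for Hamiltonicity, that "the string language `HAMCIRCUIT` is in
`P/poly`" and "`HAM_m`, read off the `m × m` Boolean matrix, has polynomial-size threshold circuits
at every `m`" coincide, and notes that "the same three steps work verbatim for any property of
`encodingGraph`-coded graphs". This file carries that remark out once and for all: for an arbitrary
set `S` of coded graphs `⟨n, G⟩` (`G` a simple graph on `Fin n`) and its string language
`encodingGraph.toLanguage S`,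

* `GraphMatrix.sliceFn S m : (Fin m × Fin m → Bool) → Bool` — the slice `x ↦ [⟨m, Gr x⟩ ∈ S]`
  (`Gr x = SimpleGraph.fromRel (x · · = true)`, the decoding convention of `encodingGraphFin`);
* `GraphMatrix.PolySize S B` / `GraphMatrix.PolySizeLin S B` — polynomial-size `B`-circuits for the
  slices on matrix inputs `Fin m × Fin m` / on the linearised matrix `Fin (m * m)`;
* `GraphMatrix.polySize_B2_of_mem_PPoly`, `polySize_tcBasis_of_polySize_B2`,
  `polySizeLin_B2_of_polySize_tcBasis` (Muroga, via `HamMatrix.exists_B2_of_tcBasis`),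
  `mem_PPoly_of_polySizeLin_B2` (the code check `HamMatrix.valid` / `HamMatrix.strFn`);
* **`GraphMatrix.mem_PPoly_iff_polySize_tcBasis : encodingGraph.toLanguage S ∈ PPoly ↔ PolySize S tcBasis`**,
  `mem_PPoly_iff_polySize_B2`, and, for an NP-complete graph language,
  **`GraphMatrix.np_subset_PPoly_iff_polySize_tcBasis`**;
* `GraphMatrix.polySize_of_eventually` — an eventual polynomial bound is as good as a bound at every
  `m` (pad the finitely many small `m` with the exponential DNF, `hasSymCircuit_of_invariant`).

All the format lemmas (`hdr`, `codeLen`, `codeBit`, `valid`, `mat`, `strFn`, `family`, …) are those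
of `HamMatrix` and are reused, not restated; only the handful of statements mentioning `hamFn` are
re-proved with `sliceFn S` in its place. Representation-independence folklore (Arora–Barak 2009,
§0.1, Def. 6.5, §6.4). Consumers: `THREECOL` (route `PneNP/SymmetryBudget`, item `RigidBenchmark`),
and any future graph property stated on matrices.

## References

* S. Arora, B. Barak, *Computational Complexity: A Modern Approach*, CUP 2009, §0.1, Def. 6.1–6.5,
  §6.4 [AroraBarak2009].
* H. Vollmer, *Introduction to Circuit Complexity* (1999), Thm. 1.20, Thm. 1.24, §4.5.2 [Vollmer1999];
  S. Jukna, *Boolean Function Complexity* (2012), §1.1–1.2 [Jukna2012].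
-/

namespace Literature.Computability.Complexity

namespace GraphMatrix

open _root_.Computability Polynomial Filter HamMatrix

variable (S : Set (Σ n, SimpleGraph (Fin n)))

open scoped Classical in
/-- The slice of the graph property `S` at `m` vertices, as a Boolean function of the `m × m`
Boolean matrix (symmetrised, loops dropped — `HamMatrix.grOf`, the decoding convention of
`encodingGraphFin`). [folklore] -/
noncomputable def sliceFn (m : ℕ) : (Fin m × Fin m → Bool) → Bool :=
  fun x => decide ((⟨m, grOf m x⟩ : Σ n, SimpleGraph (Fin n)) ∈ S)

/-- "The slices of `S` have polynomial-size matrix-input circuits over the basis `B`": one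
polynomial `p` and, at every `m`, a `B`-circuit on the `m²` matrix entries with at most `p m` gates
computing `sliceFn S m`. [folklore] -/
def PolySize (B : Set GateFn) : Prop :=
  ∃ p : Polynomial ℕ, ∀ m : ℕ, ∃ C : Circuit (Fin m × Fin m),
    C.IsOver B ∧ C.size ≤ p.eval m ∧ C.Computes (sliceFn S m)

/-- The same on the linearised matrix `Fin (m * m)`. [folklore] -/
def PolySizeLin (B : Set GateFn) : Prop :=
  ∃ p : Polynomial ℕ, ∀ m : ℕ, ∃ C : Circuit (Fin (m * m)),
    C.IsOver B ∧ C.size ≤ p.eval m ∧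
      C.Computes fun y => sliceFn S m fun q => y (finProdFinEquiv q)

variable {S}

open scoped Classical in
/-- The value of the indicator of the string language at the code of the matrix graph is the
slice. [cite: AroraBarak2009, §0.1] -/
theorem boolIndicator_encode (m : ℕ) (x : Fin m × Fin m → Bool) :
    (encodingGraph.toLanguage S).boolIndicator (encodingGraph.encode ⟨m, grOf m x⟩) = sliceFn S m x := by
  have hiff : encodingGraph.encode ⟨m, grOf m x⟩ ∈ encodingGraph.toLanguage S ↔
      (⟨m, grOf m x⟩ : Σ n, SimpleGraph (Fin n)) ∈ S :=
    encodingGraph.mem_toLanguage_iff _ _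
  unfold sliceFn
  by_cases hH : (⟨m, grOf m x⟩ : Σ n, SimpleGraph (Fin n)) ∈ S
  · rw [show (encodingGraph.toLanguage S).boolIndicator (encodingGraph.encode ⟨m, grOf m x⟩) = true from
      (Set.mem_iff_boolIndicator _ _).1 (hiff.2 hH)]
    exact (decide_eq_true hH).symm
  · have h1 : (encodingGraph.toLanguage S).boolIndicator (encodingGraph.encode ⟨m, grOf m x⟩) ≠ true :=
      fun h => hH (hiff.1 ((Set.mem_iff_boolIndicator _ _).2 h))
    rw [Bool.eq_false_iff.2 h1]
    exact (decide_eq_false hH).symm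

/-! ### From string circuits to matrix circuits -/

/-- **String circuits give matrix circuits (over `B₂`).** If the string language is in `P/poly`
then the slices have polynomial-size matrix-input `B₂`-circuits: hard-wire the header of the code,
read the adjacency block off the matrix (`HamMatrix.cktSize_codeBits`), and run the string circuit
of length `codeLen m`. [cite: AroraBarak2009, Def. 6.5 and §0.1] -/
theorem polySize_B2_of_mem_PPoly (h : encodingGraph.toLanguage S ∈ PPoly) : PolySize S B2 := by
  obtain ⟨p, hp⟩ := Set.mem_iUnion.1 h
  obtain ⟨D, hD, hdec⟩ := hp
  let q : Polynomial ℕ := X * X + 2 * X + 4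
  have hq : ∀ m, codeLen m ≤ q.eval m := fun m => by
    simp only [q, eval_add, eval_mul, eval_X, eval_ofNat]
    exact codeLen_le m
  refine ⟨q + p.comp q, fun m => ?_⟩
  set N := codeLen m with hN
  have hcomp := (cktSize_codeBits m).comp (Circuit.cktSize_eval (D N) (hD N).1)
  have hval : ∀ x : Fin m × Fin m → Bool,
      (D N).eval (fun j : Fin N => codeBit m j x) = sliceFn S m x := by
    intro x
    have h1 : (fun j : Fin N => codeBit m j x) =
        fun j : Fin N => (encodingGraph.encode ⟨m, grOf m x⟩)[(j : ℕ)]'(by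
          rw [length_encode]; exact j.2) := funext fun j => codeBit_eq_getElem m j x
    rw [h1, eval_family_cast D _ (length_encode m (grOf m x)), hdec, boolIndicator_encode]
  obtain ⟨C, hCB, hCs, hCe⟩ := (hcomp.congr fun x _ => hval x).toCircuit
  refine ⟨C, hCB, hCs.trans ?_, hCe⟩
  rw [eval_add, eval_comp]
  exact Nat.add_le_add (hq m) (((hD N).2).trans (natPoly_eval_mono p (hq m)))

/-- At `m = 0` every slice is constant (there is one `0 × 0` matrix). [folklore] -/
theorem sliceFn_zero (x : Fin 0 × Fin 0 → Bool) : sliceFn S 0 x = sliceFn S 0 fun _ => false :=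
  congrArg (sliceFn S 0) (funext fun q => q.1.elim0)

/-- Matrix `B₂`-circuits give matrix `tcBasis`-circuits (`{∧₂, ∨₂, ¬} ⊆ tcBasis`, Jukna's
`12 s + 3` simulation of `B₂` by `{∧₂, ∨₂, ¬}`; at `m = 0` the constant circuit). [cite: Jukna2012, §1.2] -/
theorem polySize_tcBasis_of_polySize_B2 (h : PolySize S B2) : PolySize S tcBasis := by
  obtain ⟨p, hp⟩ := h
  refine ⟨12 * p + 3, fun m => ?_⟩
  obtain ⟨C, hCB, hCs, hCe⟩ := hp m
  rcases Nat.eq_zero_or_pos m with rfl | hm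
  · refine ⟨Circuit.const _ (sliceFn S 0 fun _ => false), const_isOver_tcBasis _ _, ?_, fun x => ?_⟩
    · simp
    · rw [Circuit.eval_const, sliceFn_zero x]
  · obtain ⟨C', hB', hf', hs'⟩ := C.exists_deMorgan_of_B2 hCB (⟨0, hm⟩, ⟨0, hm⟩) hCe
    refine ⟨C', hB'.mono deMorganBasis_subset_tcBasis, hs'.trans ?_, hf'⟩
    simp only [eval_add, eval_mul, eval_ofNat]
    omega

/-- **Matrix `tcBasis`-circuits give linearised `B₂`-circuits of polynomial size** (Muroga's weight
bound and iterated addition, `HamMatrix.exists_B2_of_tcBasis`). [cite: Vollmer1999, §4.5.2 Cor. 4.35] -/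
theorem polySizeLin_B2_of_polySize_tcBasis (h : PolySize S tcBasis) : PolySizeLin S B2 := by
  obtain ⟨p, hp⟩ := h
  obtain ⟨g, hg⟩ := exists_poly_gadgetSize
  let r : Polynomial ℕ := X * X + p
  refine ⟨p * (g.comp r + 1), fun m => ?_⟩
  obtain ⟨C, hCB, hCs, hCe⟩ := hp m
  have h1 : CktSize tcBasis (fun (y : Fin (m * m) → Bool) (_ : Unit) =>
      C.eval fun q => y (finProdFinEquiv q)) C.size :=
    (Circuit.cktSize_eval C hCB).rewire fun q => finProdFinEquiv q
  obtain ⟨C₁, h₁B, h₁s, h₁e⟩ := h1.toCircuit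
  obtain ⟨C₂, h₂B, h₂s, h₂e⟩ := exists_B2_of_tcBasis C₁ h₁B
  refine ⟨C₂, h₂B, h₂s.trans ?_, fun y => ?_⟩
  · have hN : m * m + C₁.size ≤ r.eval m := by
      simp only [r, eval_add, eval_mul, eval_X]
      exact Nat.add_le_add_left (h₁s.trans hCs) _
    have hgad : gadgetSize (m * m + C₁.size) ≤ (g.comp r).eval m := by
      rw [eval_comp]
      exact (hg _).trans (natPoly_eval_mono g hN)
    rw [eval_mul, eval_add, eval_one]
    exact Nat.mul_le_mul (h₁s.trans hCs) (Nat.succ_le_succ hgad)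
  · rw [h₂e y, h₁e y, hCe]

/-! ### From linearised `B₂`-circuits to string circuits -/

/-- **Semantics of the string circuit `HamMatrix.strFn` on strings of length `codeLen m`**, for a
linearised circuit computing the slice of `S`. [cite: AroraBarak2009, Def. 6.5 and §0.1] -/
theorem strFn_eq_boolIndicator (m : ℕ) (C₂ : Circuit (Fin (m * m)))
    (hC : C₂.Computes fun y => sliceFn S m fun q => y (finProdFinEquiv q))
    (x : List Bool) (hx : x.length = codeLen m) :
    strFn m C₂ (fun j => x[(j : ℕ)]'(by rw [hx]; exact j.2)) = (encodingGraph.toLanguage S).boolIndicator x := by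
  set s : Fin (codeLen m) → Bool := fun j => x[(j : ℕ)]'(by rw [hx]; exact j.2) with hs
  by_cases hv : valid m s = true
  · have hxe : x = encodingGraph.encode ⟨m, grOf m (mat m s)⟩ := by
      refine List.ext_getElem (by rw [hx, length_encode]) fun j h1 h2 => ?_
      have := encode_mat_of_valid m hv ⟨j, by rw [← hx]; exact h1⟩
      exact this.symm
    rw [strFn, hv, Bool.true_and, hC, hxe, boolIndicator_encode]
    rfl
  · rw [strFn, Bool.eq_false_iff.2 hv, Bool.false_and]
    symm
    rw [← Bool.not_eq_true]
    intro hmem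
    obtain ⟨⟨n', G'⟩, -, he⟩ := (Set.mem_iff_boolIndicator _ _).2 hmem
    have hn : n' = m := by
      apply codeLen_strictMono.injective
      rw [← length_encode n' G', he, hx]
    subst hn
    apply hv
    convert valid_encode _ G' using 2
    funext j
    simp only [hs, he]

/-- **Linearised `B₂`-circuits for the slices give `encodingGraph.toLanguage S ∈ P/poly`.** At
length `codeLen m` the circuit checks that the input is a graph code with the header of `m`
(`HamMatrix.valid`) and runs the slice circuit on the block; other lengths carry no code
(`HamMatrix.family`). [cite: AroraBarak2009, Def. 6.5 and §0.1] -/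
theorem mem_PPoly_of_polySizeLin_B2 (h : PolySizeLin S B2) : encodingGraph.toLanguage S ∈ PPoly := by
  obtain ⟨p, hp⟩ := h
  choose C hCB hCs hCe using hp
  let P : Polynomial ℕ := 4 * X + 3 + p
  have hstr : ∀ m, ∃ D : Circuit (Fin (codeLen m)), D.IsOver B2 ∧ D.size ≤ P.eval (codeLen m) ∧
      ∀ (x : List Bool) (hx : x.length = codeLen m),
        D.eval (fun j => x[(j : ℕ)]'(by rw [hx]; exact j.2)) = (encodingGraph.toLanguage S).boolIndicator x := by
    intro m
    obtain ⟨D, hDB, hDs, hDe⟩ := (cktSize_strFn m (C m) (hCB m)).toCircuit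
    refine ⟨D, hDB, hDs.trans ?_, fun x hx => ?_⟩
    · have h1 := card_testIdx_le m
      have h2 : (C m).size ≤ p.eval (codeLen m) := (hCs m).trans (natPoly_eval_mono p (le_codeLen m))
      simp only [P, eval_add, eval_mul, eval_ofNat, eval_X]
      omega
    · rw [hDe, strFn_eq_boolIndicator m (C m) (hCe m) x hx]
  choose D hDB hDs hDe using hstr
  refine Set.mem_iUnion.2 ⟨P + 1, family D, fun n => ?_, fun x => ?_⟩
  · by_cases h : ∃ m, codeLen m = n
    · have hF : family D n = h.choose_spec ▸ D h.choose := dif_pos h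
      rw [hF, isOver_transport, size_transport]
      refine ⟨hDB _, (hDs _).trans ?_⟩
      rw [h.choose_spec]
      simp only [P, eval_add, eval_one, eval_mul, eval_X, eval_ofNat]
      omega
    · have hF : family D n = Circuit.const _ false := dif_neg h
      rw [hF]
      exact ⟨const_isOver_B2 _ false, by simp⟩
  · by_cases h : ∃ m, codeLen m = x.length
    · have hF : family D x.length = h.choose_spec ▸ D h.choose := dif_pos h
      rw [hF, eval_transport]
      exact hDe h.choose x h.choose_spec.symm
    · have hF : family D x.length = Circuit.const _ false := dif_neg h
      rw [hF, Circuit.eval_const]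
      symm
      rw [← Bool.not_eq_true]
      intro hmem
      obtain ⟨⟨n', G'⟩, -, he⟩ := (Set.mem_iff_boolIndicator _ _).2 hmem
      exact h ⟨n', by rw [← he, length_encode]⟩

/-! ### Summary -/

/-- **Matrix threshold circuits give `encodingGraph.toLanguage S ∈ P/poly`.** [cite: AroraBarak2009, Def. 6.5 and §0.1] -/
theorem mem_PPoly_of_polySize_tcBasis (h : PolySize S tcBasis) : encodingGraph.toLanguage S ∈ PPoly :=
  mem_PPoly_of_polySizeLin_B2 (polySizeLin_B2_of_polySize_tcBasis h)

variable (S)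

/-- **The string language of a graph property is in `P/poly` iff its slices have polynomial-size
matrix-input threshold circuits** (size = number of gates, arbitrary fan-in and multiplicities).
[cite: AroraBarak2009, Def. 6.5 and §0.1] -/
theorem mem_PPoly_iff_polySize_tcBasis : encodingGraph.toLanguage S ∈ PPoly ↔ PolySize S tcBasis :=
  ⟨fun h => polySize_tcBasis_of_polySize_B2 (polySize_B2_of_mem_PPoly h), mem_PPoly_of_polySize_tcBasis⟩

/-- The same over `B₂`. [cite: AroraBarak2009, Def. 6.5 and §0.1] -/
theorem mem_PPoly_iff_polySize_B2 : encodingGraph.toLanguage S ∈ PPoly ↔ PolySize S B2 :=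
  ⟨polySize_B2_of_mem_PPoly, fun h => mem_PPoly_of_polySize_tcBasis (polySize_tcBasis_of_polySize_B2 h)⟩

variable {S}

/-- **For an NP-complete graph language, `NP ⊆ P/poly` iff the slices have polynomial-size
matrix-input threshold circuits** (`P/poly` is closed under Karp reductions,
`NP_subset_PPoly_iff_of_isNPComplete`). [cite: AroraBarak2009, §6.4] -/
theorem np_subset_PPoly_iff_polySize_tcBasis (hS : IsNPComplete (encodingGraph.toLanguage S)) :
    Nondeterministic.NP ⊆ PPoly ↔ PolySize S tcBasis :=
  (NP_subset_PPoly_iff_of_isNPComplete hS).trans (mem_PPoly_iff_polySize_tcBasis S)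

/-! ### Eventual bounds suffice -/

/-- **An eventual polynomial size bound is a bound at every `m`**: pad the finitely many `m < N`
with the exponential DNF (`hasSymCircuit_of_invariant` with the trivial group: every function of an
`m × m` matrix has a `tcBasis`-circuit with `2^(m²) + m² + 1` gates) and add that constant to the
polynomial. [folklore] -/
theorem polySize_of_eventually
    (h : ∃ p : Polynomial ℕ, ∀ᶠ m in atTop, ∃ C : Circuit (Fin m × Fin m),
      C.IsOver tcBasis ∧ C.size ≤ p.eval m ∧ C.Computes (sliceFn S m)) :
    PolySize S tcBasis := by
  obtain ⟨p, hp⟩ := h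
  obtain ⟨N, hN⟩ := eventually_atTop.1 hp
  refine ⟨p + Polynomial.C (2 ^ (N * N) + N * N + 1), fun m => ?_⟩
  by_cases hm : N ≤ m
  · obtain ⟨C, hCB, hCs, hCe⟩ := hN m hm
    exact ⟨C, hCB, hCs.trans (by simp), hCe⟩
  · obtain ⟨C, hCB, hCs, -, hCe⟩ := hasSymCircuit_of_invariant (sliceFn S m) (∅ : Set (Equiv.Perm (Fin m)))
      (fun ρ hρ => absurd hρ (Set.notMem_empty ρ))
    refine ⟨C, hCB, hCs.trans ?_, hCe⟩
    have hmN : m ≤ N := le_of_lt (not_le.1 hm)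
    have h1 : 2 ^ (m * m) ≤ 2 ^ (N * N) := Nat.pow_le_pow_right (by norm_num) (Nat.mul_le_mul hmN hmN)
    have h2 : m * m ≤ N * N := Nat.mul_le_mul hmN hmN
    simp only [eval_add, eval_C]
    omega

/-- Hence: **the string language is in `P/poly` iff the slices EVENTUALLY have polynomial-size
matrix threshold circuits.** [cite: AroraBarak2009, Def. 6.5 and §0.1] -/
theorem mem_PPoly_iff_eventually_polySize :
    encodingGraph.toLanguage S ∈ PPoly ↔ ∃ p : Polynomial ℕ, ∀ᶠ m in atTop, ∃ C : Circuit (Fin m × Fin m),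
      C.IsOver tcBasis ∧ C.size ≤ p.eval m ∧ C.Computes (sliceFn S m) := by
  rw [mem_PPoly_iff_polySize_tcBasis]
  exact ⟨fun ⟨p, hp⟩ => ⟨p, Eventually.of_forall hp⟩, polySize_of_eventually⟩

end GraphMatrix

end Literature.Computability.Complexity
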